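import Mathlib
import HarnessLib
import Summits.NavierStokesRegularity.NavierStokesRegularity.Theorems.HalfSpaceWindowDoorCirculationCarryingRigidityConeFluxSubsolution
import Summits.NavierStokesRegularity.NavierStokesRegularity.Theorems.HalfSpaceWindowDoorCirculationCarryingRigidityWholeSpaceMaxPrinciple
import Summits.NavierStokesRegularity.NavierStokesRegularity.Theorems.HalfSpaceWindowDoorCirculationCarryingRigidityGaussExtremalTilting
import Literature.Analysis.FluidPDE.MeridianReduction
import Literature.Analysis.FluidPDE.KNSSSwirlTransport
import Literature.Analysis.FluidPDE.AxisymQuotientEquations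

/-!
# Route `HalfSpaceWindowDoor`, crux `CirculationCarryingRigidity` (stmt-NavierStokesRegularity-25311) —
# line `cone_sweep`, FAR-FIELD form, Steps 1–2: the sweeping lemma with the cone only on FAR circles about ONE axis

LEAD ns-hsw-p1 g9, `--supports stmt-NavierStokesRegularity-25311 --as helper`; card `Cruxes/…/Lines/cone_sweep.md`.  Generalisation of
`…ConeSweeping` (p682336): the pointwise cone is replaced by the CIRCLE-AVERAGED cone `∮|ω_h| dl ≤ K∮ω₃ dl` (AxisTwistDoor's `GlobalCone` form)
required ONLY on circles about the `e₃`-axis with `r ≥ R₀√(−s)`; the barrier is active only on `r > R₁√(−s)`, `R₁ = 4C(1+K)+R₀+1`, so the proof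
of p682336 goes through verbatim (`circ_le_of_farCone_aux`, SWEEPING LEMMA `circ_le_sSup_of_farCone`, finite plane flux `circ_le_const_of_farCone`).
Steps 3–4: `…FarConeRigidity`, `…FarConeLiouville`.  WHAT THIS IS NOT: not about NS regularity; HYPOTHETICAL profiles.  No item closed.
-/

noncomputable section

-- the summit and its single sub-problem share the name (CONVENTIONS §1), as in every Theorems file
set_option linter.dupNamespace false

namespace Summit.NavierStokesRegularity.NavierStokesRegularity.Theorems.HalfSpaceWindowDoorCirculationCarryingRigidityFarConeSweeping

open MeasureTheory Set Function Filter Topology InnerProductSpace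
open scoped RealInnerProductSpace InnerProductSpace Laplacian
open Literature.Analysis Literature.Analysis.FluidPDE Literature.Analysis.UnboundedOperators
open Summit.NavierStokesRegularity.NavierStokesRegularity.Theses.HalfSpaceWindowDoor
open Summit.NavierStokesRegularity.NavierStokesRegularity.Theorems.HalfSpaceWindowDoorCirculationCarryingRigidityDefs
  (InDoorClass SignE3 e3)
open Summit.NavierStokesRegularity.NavierStokesRegularity.Theorems.AxisTwistDoorAveragedConeLiouvilleDefs
  (cylPt eT circ vortCirc tiltCirc circleTerm)
open Summit.NavierStokesRegularity.NavierStokesRegularity.Theorems.AveragedConeLiouville.CircleStokes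
  (deriv_circ_eq_vortCirc)
open Summit.NavierStokesRegularity.NavierStokesRegularity.Theorems.AveragedConeLiouville.CircMonotone
  (circ_zero circ_mono circ_nonneg vortCirc_nonneg)
open Summit.NavierStokesRegularity.NavierStokesRegularity.Theorems.HalfSpaceWindowDoorCirculationCarryingRigidityAxisCirculation
  (contDiff_circF isSmoothSpaceTimeOn_circF isSmoothSpaceTimeOn_of_class fderiv_circF_eR laplacian_circF hasDerivAt_circF_time)
open Summit.NavierStokesRegularity.NavierStokesRegularity.Theorems.HalfSpaceWindowDoorCirculationCarryingRigidityAxisCirculationDynamics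
  (abs_circleTerm_le_cone deriv_circ_s_eq)
open Summit.NavierStokesRegularity.NavierStokesRegularity.Theorems.HalfSpaceWindowDoorCirculationCarryingRigidityWholeSpaceMaxPrinciple
  (le_of_subsolution)
open Summit.NavierStokesRegularity.NavierStokesRegularity.Theorems.PoloidalWindowDoorPoloidalWindowRigidityClassSpaceTimeRates
  (exists_fderiv_rate_of_class')

open Summit.NavierStokesRegularity.NavierStokesRegularity.Theorems.HalfSpaceWindowDoorCirculationCarryingRigidityConeFluxSubsolution

variable {C : ℝ} {v : ℝ → EuclideanSpace ℝ (Fin 3) → EuclideanSpace ℝ (Fin 3)}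
/-- **Step 1, far-field form**: on a circle carrying the circle cone, `−T ≤ (C(1+K)/√(−s))·∮ω₃ dl`. -/
theorem neg_circleTerm_le_far (hv : InDoorClass C v) (hsign : SignE3 v) {K s r : ℝ} {z : ℝ}
    (hcone : tiltCirc v r z s ≤ K * vortCirc v r z s) (hs : s < 0) (hr : 0 ≤ r) :
    -circleTerm v r z s ≤ C * (1 + K) / Real.sqrt (-s) * vortCirc v r z s := by
  have hsq : 0 < Real.sqrt (-s) := Real.sqrt_pos.2 (neg_pos.2 hs)
  have hC : 0 ≤ C := HalfSpaceWindowDoorCirculationCarryingRigidityConeFluxSubsolution.typeI_const_nonneg hv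
  have h := abs_circleTerm_le_cone (contDiff_one_slice hv hs) (signE3_atd hsign s hs) hr (fun θ => hv.1 s hs _)
    (div_nonneg hC hsq.le) hcone
  have h2 : -circleTerm v r z s ≤ |circleTerm v r z s| := neg_le_abs _
  calc -circleTerm v r z s ≤ (1 + K) * (C / Real.sqrt (-s)) * vortCirc v r z s := h2.trans h
    _ = C * (1 + K) / Real.sqrt (-s) * vortCirc v r z s := by ring

set_option maxHeartbeats 800000 in
/-- **Step 2 with the barrier** (far-field form): `Γ(r,z,s) ≤ μ + A r²/(√(−s)√(−s₀))` on `[s₀,s₁]`, `μ = sup{Γ(R₁√(−s'),z',s') : s' ≤ s₁}`. -/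
theorem circ_le_of_farCone_aux (hv : InDoorClass C v) (hsign : SignE3 v) {K : ℝ} (hK : 0 ≤ K)
    {R₀ : ℝ} (hR₀ : 0 ≤ R₀) (hcone : ∀ s < 0, ∀ r : ℝ, R₀ * Real.sqrt (-s) ≤ r → ∀ z : ℝ, tiltCirc v r z s ≤ K * vortCirc v r z s)
    {K₁ : ℝ} (hK₁0 : 0 ≤ K₁) (hK₁ : ∀ s < 0, ∀ x, ‖fderiv ℝ (v s) x‖ ≤ K₁ / (-s))
    {s₀ s₁ : ℝ} (hs₀₁ : s₀ < s₁) (hs₁ : s₁ < 0) :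
    ∀ s ∈ Icc s₀ s₁, ∀ r : ℝ, 0 ≤ r → ∀ z : ℝ,
      circ v r z s ≤ sSup {m : ℝ | ∃ s' : ℝ, s' ≤ s₁ ∧ ∃ z' : ℝ, m = circ v ((4 * (C * (1 + K)) + R₀ + 1) * Real.sqrt (-s')) z' s'} +
        Real.pi * (4 * K₁ + 1) * r ^ 2 / (Real.sqrt (-s) * Real.sqrt (-s₀)) := by
  set B : ℝ := C * (1 + K) with hB
  set R₁ : ℝ := 4 * B + R₀ + 1 with hR₁
  set A : ℝ := Real.pi * (4 * K₁ + 1) with hA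
  set S : Set ℝ := {m : ℝ | ∃ s' : ℝ, s' ≤ s₁ ∧ ∃ z' : ℝ, m = circ v (R₁ * Real.sqrt (-s')) z' s'} with hS
  set μ : ℝ := sSup S with hμ
  have hs₀ : s₀ < 0 := hs₀₁.trans hs₁
  have hsq₀ : 0 < Real.sqrt (-s₀) := Real.sqrt_pos.2 (neg_pos.2 hs₀)
  have hsq₁ : 0 < Real.sqrt (-s₁) := Real.sqrt_pos.2 (neg_pos.2 hs₁)
  have hC : 0 ≤ C := HalfSpaceWindowDoorCirculationCarryingRigidityConeFluxSubsolution.typeI_const_nonneg hv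
  have hB0 : 0 ≤ B := by positivity
  have hR₁pos : 0 < R₁ := by positivity
  have hApos : 0 < A := by positivity
  obtain ⟨hSbdd, hSle⟩ := tube_bddAbove hv hR₁pos.le hs₁
  have hμ_ge : ∀ s' ≤ s₁, ∀ z', circ v (R₁ * Real.sqrt (-s')) z' s' ≤ μ := fun s' hs' z' =>
    le_csSup hSbdd ⟨s', hs', z', rfl⟩
  have hμ0 : 0 ≤ μ := by
    refine le_trans ?_ (hμ_ge s₁ le_rfl 0)
    exact circ_nonneg v (contDiff_one_slice hv hs₁) (signE3_atd hsign) hs₁ (by positivity) 0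
  -- the smooth structure
  have hsm := isSmoothSpaceTimeOn_of_class hv.1 hv.2.1 hv.2.2.1 hv.2.2.2
  have hsmF := isSmoothSpaceTimeOn_circF hsm
  -- vorticity bound `ω₃ ≤ 4K₁/(−s)` and the quadratic bound at `s₀`
  have hω3 : ∀ s < 0, ∀ x, curl (v s) x 2 ≤ (4 * K₁ + 1) / (-s) := fun s hs x => omega3_le_of_rate hK₁ hs x
  -- the comparison function `q`
  set F : ℝ → EuclideanSpace ℝ (Fin 3) → ℝ := fun t x => (2 * Real.pi)⁻¹ * circ v (cylRadius x) (x 2) t with hF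
  set φ : ℝ → EuclideanSpace ℝ (Fin 3) → ℝ := fun t x =>
    (2 * Real.pi)⁻¹ * (μ + A * (Real.sqrt (-t) * Real.sqrt (-s₀))⁻¹ * (x 0 * x 0 + x 1 * x 1)) with hφ
  set q : ℝ → EuclideanSpace ℝ (Fin 3) → ℝ := fun t x => F t x - φ t x with hq
  set b : ℝ → EuclideanSpace ℝ (Fin 3) → EuclideanSpace ℝ (Fin 3) := fun t x =>
    (2 / cylRadius x - B / Real.sqrt (-t)) • Literature.Analysis.FluidPDE.eR x with hb
  have h2π : 0 < 2 * Real.pi := by positivity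
  have hproj : ∀ (i : Fin 3) (w : EuclideanSpace ℝ (Fin 3)), EuclideanSpace.proj (𝕜 := ℝ) i w = w i := fun i w => rfl
  have hci : ∀ i : Fin 3, ContDiff ℝ 2 fun y : EuclideanSpace ℝ (Fin 3) => y i := fun i =>
    (EuclideanSpace.proj (𝕜 := ℝ) i : EuclideanSpace ℝ (Fin 3) →L[ℝ] ℝ).contDiff
  have hQc : ContDiff ℝ 2 fun y : EuclideanSpace ℝ (Fin 3) => y 0 * y 0 + y 1 * y 1 :=
    ((hci 0).mul (hci 0)).add ((hci 1).mul (hci 1))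
  have hQsq : (fun y : EuclideanSpace ℝ (Fin 3) => y 0 * y 0 + y 1 * y 1) = fun y => y 0 ^ 2 + y 1 ^ 2 := by
    funext y; ring
  have hφ2 : ∀ t, ContDiff ℝ 2 (φ t) := fun t =>
    contDiff_const.mul (contDiff_const.add (contDiff_const.mul hQc))
  have hcontq : ContinuousOn (uncurry q) (Icc s₀ s₁ ×ˢ univ) := by
    have hFc : ContinuousOn (uncurry F) (Icc s₀ s₁ ×ˢ univ) :=
      hsmF.continuousOn.mono (prod_mono (fun t ht => lt_of_le_of_lt ht.2 hs₁) Subset.rfl)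
    have hφc : ContinuousOn (uncurry φ) (Icc s₀ s₁ ×ˢ univ) := by
      have hcont_yi : ∀ i : Fin 3, Continuous fun y : EuclideanSpace ℝ (Fin 3) => y i := fun i =>
        (continuous_apply i).comp (PiLp.continuous_ofLp 2 _)
      have hQ : Continuous fun p : ℝ × EuclideanSpace ℝ (Fin 3) => p.2 0 * p.2 0 + p.2 1 * p.2 1 :=
        (((hcont_yi 0).comp continuous_snd).mul ((hcont_yi 0).comp continuous_snd)).add
          (((hcont_yi 1).comp continuous_snd).mul ((hcont_yi 1).comp continuous_snd))
      have hinv : ContinuousOn (fun p : ℝ × EuclideanSpace ℝ (Fin 3) => (Real.sqrt (-p.1) * Real.sqrt (-s₀))⁻¹)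
          (Icc s₀ s₁ ×ˢ univ) := by
        refine ContinuousOn.inv₀ ?_ fun p hp => ?_
        · exact ((Real.continuous_sqrt.comp (continuous_neg.comp continuous_fst)).mul continuous_const).continuousOn
        · have ht : p.1 < 0 := lt_of_le_of_lt (mem_prod.1 hp).1.2 hs₁
          exact mul_ne_zero (Real.sqrt_pos.2 (neg_pos.2 ht)).ne' hsq₀.ne'
      exact continuousOn_const.mul (continuousOn_const.add ((continuousOn_const.mul hinv).mul hQ.continuousOn))
    exact hFc.sub hφc
  have hBup : ∀ t ∈ Icc s₀ s₁, ∀ x, q t x ≤ Real.pi * (C / Real.sqrt (-s₁)) ^ 2 * (-s₀) / (2 * A) := by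
    intro t ht x
    have ht0 : t < 0 := lt_of_le_of_lt ht.2 hs₁
    have hsqt : 0 < Real.sqrt (-t) := Real.sqrt_pos.2 (neg_pos.2 ht0)
    set ρ := cylRadius x with hρ
    have hρ0 : 0 ≤ ρ := cylRadius_nonneg x
    have hρ2 : ρ ^ 2 = x 0 * x 0 + x 1 * x 1 := by rw [cylRadius_sq x]; ring
    set a : ℝ := C / Real.sqrt (-s₁) with ha
    have h1 : circ v ρ (x 2) t ≤ 2 * Real.pi * ρ * a := by
      refine (circ_le_linear hv ht0 hρ0 (x 2)).trans ?_
      have : C / Real.sqrt (-t) ≤ C / Real.sqrt (-s₁) :=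
        div_le_div_of_nonneg_left hC hsq₁ (Real.sqrt_le_sqrt (by linarith [ht.2]))
      exact mul_le_mul_of_nonneg_left this (by positivity)
    set u : ℝ := -s₀ with hu
    have hu0 : 0 < u := neg_pos.2 hs₀
    have h2 : A * ρ ^ 2 / u ≤ A * (Real.sqrt (-t) * Real.sqrt (-s₀))⁻¹ * (x 0 * x 0 + x 1 * x 1) := by
      rw [← hρ2, div_eq_mul_inv, mul_assoc, mul_comm (ρ ^ 2), ← mul_assoc]
      refine mul_le_mul_of_nonneg_right (mul_le_mul_of_nonneg_left ?_ hApos.le) (sq_nonneg _)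
      have hst : Real.sqrt (-t) * Real.sqrt (-s₀) ≤ u := by
        have h' : Real.sqrt (-t) ≤ Real.sqrt (-s₀) := Real.sqrt_le_sqrt (by linarith [ht.1])
        calc Real.sqrt (-t) * Real.sqrt (-s₀) ≤ Real.sqrt (-s₀) * Real.sqrt (-s₀) := mul_le_mul_of_nonneg_right h' hsq₀.le
          _ = u := Real.mul_self_sqrt hu0.le
      exact inv_anti₀ (by positivity) hst
    have hkey : 2 * Real.pi * ρ * a - A * ρ ^ 2 / u ≤ Real.pi ^ 2 * a ^ 2 * u / A := quad_sub_sq_le hApos hu0 ρ a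
    show (2 * Real.pi)⁻¹ * circ v ρ (x 2) t -
        (2 * Real.pi)⁻¹ * (μ + A * (Real.sqrt (-t) * Real.sqrt (-s₀))⁻¹ * (x 0 * x 0 + x 1 * x 1)) ≤
      Real.pi * a ^ 2 * u / (2 * A)
    rw [← mul_sub]
    have e2 : Real.pi * a ^ 2 * u / (2 * A) = (2 * Real.pi)⁻¹ * (Real.pi ^ 2 * a ^ 2 * u / A) := by
      field_simp
    rw [e2]
    refine mul_le_mul_of_nonneg_left ?_ (by positivity)
    linarith
  have hinit : ∀ x, q s₀ x ≤ 0 := by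
    intro x
    set ρ := cylRadius x with hρ
    have hρ0 : 0 ≤ ρ := cylRadius_nonneg x
    have hρ2 : ρ ^ 2 = x 0 * x 0 + x 1 * x 1 := by rw [cylRadius_sq x]; ring
    have hM : ∀ y, curl (v s₀) y 2 ≤ (4 * K₁ + 1) / (-s₀) := hω3 s₀ hs₀
    have h1 := circ_le_sq hv hs₀ hM hρ0 (x 2)
    have h2 : Real.pi * ρ ^ 2 * ((4 * K₁ + 1) / (-s₀)) = A * (Real.sqrt (-s₀) * Real.sqrt (-s₀))⁻¹ * (x 0 * x 0 + x 1 * x 1) := by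
      rw [Real.mul_self_sqrt (neg_pos.2 hs₀).le, ← hρ2, hA]; field_simp
    show (2 * Real.pi)⁻¹ * circ v ρ (x 2) s₀ -
        (2 * Real.pi)⁻¹ * (μ + A * (Real.sqrt (-s₀) * Real.sqrt (-s₀))⁻¹ * (x 0 * x 0 + x 1 * x 1)) ≤ 0
    rw [← mul_sub]
    refine mul_nonpos_of_nonneg_of_nonpos (by positivity) ?_
    have h3 := h1.trans_eq h2
    linarith
  have hsub : ∀ t ∈ Ioc s₀ s₁, ∀ x, 0 < q t x →
      ‖b t x‖ ≤ (2 / R₁ + B) / Real.sqrt (-s₁) ∧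
      (∃ U : Set (EuclideanSpace ℝ (Fin 3)), IsOpen U ∧ x ∈ U ∧ ContDiffOn ℝ 2 (q t) U) ∧
      (∃ d : ℝ, HasDerivAt (fun τ => q τ x) d t ∧ d + fderiv ℝ (q t) x (b t x) - (Δ (q t)) x ≤ 0) := by
    intro t ht x hqpos
    have ht0 : t < 0 := lt_of_le_of_lt ht.2 hs₁
    have hsqt : 0 < Real.sqrt (-t) := Real.sqrt_pos.2 (neg_pos.2 ht0)
    have hv1 := contDiff_one_slice hv ht0
    set ρ := cylRadius x with hρ
    have hρ0 : 0 ≤ ρ := cylRadius_nonneg x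
    have hρ2 : ρ ^ 2 = x 0 * x 0 + x 1 * x 1 := by rw [cylRadius_sq x]; ring
    set κ : ℝ := A * (Real.sqrt (-t) * Real.sqrt (-s₀))⁻¹ with hκ
    have hκ0 : 0 ≤ κ := by positivity
    have hρR : R₁ * Real.sqrt (-t) < ρ := by
      by_contra hle
      push Not at hle
      have hmono := circ_mono v hv1 (signE3_atd hsign) ht0 hρ0 hle (x 2)
      have hμ' := hμ_ge t ht.2 (x 2)
      have hQ0 : 0 ≤ κ * (x 0 * x 0 + x 1 * x 1) := by rw [← hρ2]; positivity
      have : q t x ≤ 0 := by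
        show (2 * Real.pi)⁻¹ * circ v ρ (x 2) t -
            (2 * Real.pi)⁻¹ * (μ + A * (Real.sqrt (-t) * Real.sqrt (-s₀))⁻¹ * (x 0 * x 0 + x 1 * x 1)) ≤ 0
        rw [← mul_sub]
        refine mul_nonpos_of_nonneg_of_nonpos (by positivity) ?_
        have : A * (Real.sqrt (-t) * Real.sqrt (-s₀))⁻¹ * (x 0 * x 0 + x 1 * x 1) = κ * (x 0 * x 0 + x 1 * x 1) := by rw [hκ]
        linarith
      linarith
    have hρpos : 0 < ρ := lt_of_le_of_lt (by positivity) hρR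
    have hρne : cylRadius x ≠ 0 := hρpos.ne'
    have hρ4B : 4 * B * Real.sqrt (-t) ≤ ρ := by
      have : 4 * B * Real.sqrt (-t) ≤ R₁ * Real.sqrt (-t) := by rw [hR₁]; nlinarith [hsqt.le, hR₀]
      exact this.trans hρR.le
    refine ⟨?_, ⟨univ, isOpen_univ, mem_univ _, ?_⟩, ?_⟩
    · exact norm_radialDrift_le hB0 hR₁pos hs₁ ht.2 hρR
    · have hF2 : ContDiff ℝ 2 (F t) := contDiff_circF ((hsm.contDiff_slice ht0).of_le (by norm_cast))
      exact (hF2.sub (hφ2 t)).contDiffOn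
    · have hF2 : ContDiff ℝ 2 (F t) := contDiff_circF ((hsm.contDiff_slice ht0).of_le (by norm_cast))
      have hFt := hasDerivAt_circF_time hsm ht0 x
      have hlaw := deriv_circ_s_eq hv.1 hv.2.1 hv.2.2.1 hv.2.2.2 ht0 hρpos (x 2)
      set D : ℝ := -(-(1 / (2 * Real.sqrt (-t))) * Real.sqrt (-s₀)) / (Real.sqrt (-t) * Real.sqrt (-s₀)) ^ 2 with hDdef
      have hφt : HasDerivAt (fun τ => φ τ x) ((2 * Real.pi)⁻¹ * (A * D * (x 0 * x 0 + x 1 * x 1))) t :=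
        ((((hasDerivAt_invSqrt_mul ht0 hs₀).const_mul A).mul_const (x 0 * x 0 + x 1 * x 1)).const_add μ).const_mul
          ((2 * Real.pi)⁻¹)
      have hAD : A * D = κ / (2 * (-t)) := by
        have htt : Real.sqrt (-t) ^ 2 = -t := Real.sq_sqrt (neg_pos.2 ht0).le
        rw [hκ, hDdef]
        exact barrier_deriv_aux A _ _ _ hsqt hsq₀ htt
      have hQ := HalfSpaceWindowDoorCirculationCarryingRigidityConeFluxSubsolution.hasFDerivAt_horizSq x
      have hφ_has : HasFDerivAt (φ t)
          ((2 * Real.pi)⁻¹ • (κ • ((x 0 • EuclideanSpace.proj (𝕜 := ℝ) (0 : Fin 3) + x 0 • EuclideanSpace.proj (𝕜 := ℝ) (0 : Fin 3)) +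
            (x 1 • EuclideanSpace.proj (𝕜 := ℝ) (1 : Fin 3) + x 1 • EuclideanSpace.proj (𝕜 := ℝ) (1 : Fin 3))))) x :=
        ((hQ.const_mul κ).const_add μ).const_mul ((2 * Real.pi)⁻¹)
      have heR0 : (Literature.Analysis.FluidPDE.eR x) 0 = ρ⁻¹ * x 0 := by
        simp [Literature.Analysis.FluidPDE.eR, hρ]
      have heR1 : (Literature.Analysis.FluidPDE.eR x) 1 = ρ⁻¹ * x 1 := by
        simp [Literature.Analysis.FluidPDE.eR, hρ]
      have hb0 : (b t x) 0 = (2 / ρ - B / Real.sqrt (-t)) * (ρ⁻¹ * x 0) := by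
        show ((2 / cylRadius x - B / Real.sqrt (-t)) • Literature.Analysis.FluidPDE.eR x) 0 = _
        rw [PiLp.smul_apply, smul_eq_mul, heR0]
      have hb1 : (b t x) 1 = (2 / ρ - B / Real.sqrt (-t)) * (ρ⁻¹ * x 1) := by
        show ((2 / cylRadius x - B / Real.sqrt (-t)) • Literature.Analysis.FluidPDE.eR x) 1 = _
        rw [PiLp.smul_apply, smul_eq_mul, heR1]
      have hφ_fd : fderiv ℝ (φ t) x (b t x) = (2 * Real.pi)⁻¹ * (κ * ((2 / ρ - B / Real.sqrt (-t)) * (2 * ρ))) := by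
        rw [hφ_has.fderiv]
        simp only [smul_apply, add_apply, hproj, smul_eq_mul, hb0, hb1]
        have e : x 0 * ((2 / ρ - B / Real.sqrt (-t)) * (ρ⁻¹ * x 0)) + x 0 * ((2 / ρ - B / Real.sqrt (-t)) * (ρ⁻¹ * x 0)) +
            (x 1 * ((2 / ρ - B / Real.sqrt (-t)) * (ρ⁻¹ * x 1)) + x 1 * ((2 / ρ - B / Real.sqrt (-t)) * (ρ⁻¹ * x 1))) =
            (2 / ρ - B / Real.sqrt (-t)) * (2 * (ρ⁻¹ * (x 0 * x 0 + x 1 * x 1))) := by ring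
        rw [e, ← hρ2, pow_two, ← mul_assoc ρ⁻¹, inv_mul_cancel₀ hρne, one_mul]
      have hφ_lap : (Δ (φ t)) x = (2 * Real.pi)⁻¹ * (κ * 4) := by
        have e : φ t = (fun _ : EuclideanSpace ℝ (Fin 3) => (2 * Real.pi)⁻¹ * μ) +
            ((2 * Real.pi)⁻¹ * κ) • (fun y : EuclideanSpace ℝ (Fin 3) => y 0 ^ 2 + y 1 ^ 2) := by
          funext y
          simp only [hφ, hκ, Pi.add_apply, Pi.smul_apply, smul_eq_mul]
          ring
        rw [e]
        have hc1 : ContDiffAt ℝ 2 (fun _ : EuclideanSpace ℝ (Fin 3) => (2 * Real.pi)⁻¹ * μ) x := contDiffAt_const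
        have hsq2 : ContDiffAt ℝ 2 (fun y : EuclideanSpace ℝ (Fin 3) => y 0 ^ 2 + y 1 ^ 2) x := by
          rw [← hQsq]; exact hQc.contDiffAt
        have hc2 : ContDiffAt ℝ 2 (((2 * Real.pi)⁻¹ * κ) • fun y : EuclideanSpace ℝ (Fin 3) => y 0 ^ 2 + y 1 ^ 2) x := by
          rw [Pi.smul_def]; exact hsq2.const_smul ((2 * Real.pi)⁻¹ * κ)
        rw [ContDiffAt.laplacian_add hc1 hc2, InnerProductSpace.laplacian_smul _ hsq2,
          Literature.Analysis.FluidPDE.laplacian_rho x]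
        simp [smul_eq_mul]
        ring
      have hFr := fderiv_circF_eR hsm ht0 x
      have hFΔ := laplacian_circF hsm ht0 hρne
      have hFb : fderiv ℝ (F t) x (b t x) = (2 / ρ - B / Real.sqrt (-t)) * ((2 * Real.pi)⁻¹ * vortCirc v ρ (x 2) t) := by
        show fderiv ℝ (F t) x ((2 / cylRadius x - B / Real.sqrt (-t)) • Literature.Analysis.FluidPDE.eR x) = _
        rw [map_smul, smul_eq_mul, hFr]
      have hΔq : (Δ (q t)) x = (Δ (F t)) x - (Δ (φ t)) x :=
        ContDiffAt.laplacian_sub hF2.contDiffAt (hφ2 t).contDiffAt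
      have hDq : fderiv ℝ (q t) x (b t x) = fderiv ℝ (F t) x (b t x) - fderiv ℝ (φ t) x (b t x) := by
        have e : q t = fun y => F t y - φ t y := rfl
        rw [e, fderiv_fun_sub ((hF2.differentiable (by norm_num)).differentiableAt) hφ_has.differentiableAt]
        rfl
      have hFΔ' : (Δ (F t)) x = (2 * Real.pi)⁻¹ * (deriv (fun r' => deriv (fun r'' => circ v r'' (x 2) t) r') ρ
          + ρ⁻¹ * deriv (fun r' => circ v r' (x 2) t) ρ
          + deriv (fun z' => deriv (fun z'' => circ v ρ z'' t) z') (x 2)) := hFΔ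
      rw [← hρ] at hFt
      refine ⟨_, hFt.sub hφt, ?_⟩
      have hρR₀ : R₀ * Real.sqrt (-t) ≤ ρ := by
        have : R₀ * Real.sqrt (-t) ≤ R₁ * Real.sqrt (-t) := by rw [hR₁]; nlinarith [hsqt.le]
        exact this.trans hρR.le
      have hStep1 := neg_circleTerm_le_far hv hsign (hcone t ht0 ρ hρR₀ (x 2)) ht0 hρ0
      have hΓr0 : 0 ≤ vortCirc v ρ (x 2) t := vortCirc_nonneg v (signE3_atd hsign) ht0 hρ0 _
      have hΓr' : deriv (fun r' => circ v r' (x 2) t) ρ = vortCirc v ρ (x 2) t := deriv_circ_eq_vortCirc v hv1 ρ (x 2)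
      rw [hDq, hΔq, hFb, hφ_fd, hφ_lap, hFΔ', hlaw, hΓr']
      set Γr := vortCirc v ρ (x 2) t with hΓr
      set Γrr := deriv (fun r' => deriv (fun r'' => circ v r'' (x 2) t) r') ρ
      set Γzz := deriv (fun z' => deriv (fun z'' => circ v ρ z'' t) z') (x 2)
      set T := circleTerm v ρ (x 2) t
      have hbar : 0 ≤ (2 * Real.pi)⁻¹ * (A * D * (x 0 * x 0 + x 1 * x 1))
          + (2 * Real.pi)⁻¹ * (κ * ((2 / ρ - B / Real.sqrt (-t)) * (2 * ρ))) - (2 * Real.pi)⁻¹ * (κ * 4) := by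
        rw [← hρ2, show A * D * ρ ^ 2 = (A * D) * ρ ^ 2 by ring, hAD]
        have htt : Real.sqrt (-t) ^ 2 = -t := Real.sq_sqrt (neg_pos.2 ht0).le
        set σ : ℝ := Real.sqrt (-t) with hσ
        have e0 : (2 / ρ - B / σ) * (2 * ρ) = 4 - 2 * B * ρ / σ := by
          field_simp
          ring
        rw [e0, ← htt]
        have e1 : (2 * Real.pi)⁻¹ * (κ / (2 * σ ^ 2) * ρ ^ 2) + (2 * Real.pi)⁻¹ * (κ * (4 - 2 * B * ρ / σ))
            - (2 * Real.pi)⁻¹ * (κ * 4) = (2 * Real.pi)⁻¹ * κ * (ρ / σ) * ((ρ - 4 * B * σ) / (2 * σ)) := by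
          field_simp
          ring
        rw [e1]
        have h4 : 0 ≤ (ρ - 4 * B * σ) / (2 * σ) := div_nonneg (by linarith) (by positivity)
        have : 0 ≤ ρ / σ := by positivity
        exact mul_nonneg (mul_nonneg (mul_nonneg (by positivity) hκ0) this) h4
      have hT : -T ≤ B / Real.sqrt (-t) * Γr := by
        have : C * (1 + K) / Real.sqrt (-t) * Γr = B / Real.sqrt (-t) * Γr := by rw [hB]
        linarith [hStep1]
      have key : (2 * Real.pi)⁻¹ * (Γrr - ρ⁻¹ * Γr + Γzz - T) - (2 * Real.pi)⁻¹ * (A * D * (x 0 * x 0 + x 1 * x 1)) +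
          ((2 / ρ - B / Real.sqrt (-t)) * ((2 * Real.pi)⁻¹ * Γr) - (2 * Real.pi)⁻¹ * (κ * ((2 / ρ - B / Real.sqrt (-t)) * (2 * ρ)))) -
          ((2 * Real.pi)⁻¹ * (Γrr + ρ⁻¹ * Γr + Γzz) - (2 * Real.pi)⁻¹ * (κ * 4)) =
          (2 * Real.pi)⁻¹ * (-T - B / Real.sqrt (-t) * Γr) -
          ((2 * Real.pi)⁻¹ * (A * D * (x 0 * x 0 + x 1 * x 1))
            + (2 * Real.pi)⁻¹ * (κ * ((2 / ρ - B / Real.sqrt (-t)) * (2 * ρ))) - (2 * Real.pi)⁻¹ * (κ * 4)) := by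
        ring
      rw [key]
      have h1 : (2 * Real.pi)⁻¹ * (-T - B / Real.sqrt (-t) * Γr) ≤ 0 :=
        mul_nonpos_of_nonneg_of_nonpos (by positivity) (by linarith)
      linarith
  have hmp := le_of_subsolution (m := 0) (by positivity : (0:ℝ) ≤ (2 / R₁ + B) / Real.sqrt (-s₁)) hcontq hBup hinit hsub
  intro s hs r hr z
  have hs0 : s < 0 := lt_of_le_of_lt hs.2 hs₁
  have hsqs : 0 < Real.sqrt (-s) := Real.sqrt_pos.2 (neg_pos.2 hs0)
  have hx := hmp s hs (cylPt r 0 z)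
  have hrad : cylRadius (cylPt r 0 z) = r := by
    rw [cylRadius]
    simp [cylPt, Real.sqrt_sq hr]
  have hz : (cylPt r 0 z) 2 = z := by simp [cylPt]
  have h0 : (cylPt r 0 z) 0 * (cylPt r 0 z) 0 + (cylPt r 0 z) 1 * (cylPt r 0 z) 1 = r ^ 2 := by simp [cylPt]; ring
  have hq' : (2 * Real.pi)⁻¹ * circ v r z s -
      (2 * Real.pi)⁻¹ * (μ + A * (Real.sqrt (-s) * Real.sqrt (-s₀))⁻¹ * r ^ 2) ≤ 0 := by
    change (2 * Real.pi)⁻¹ * circ v (cylRadius (cylPt r 0 z)) ((cylPt r 0 z) 2) s -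
      (2 * Real.pi)⁻¹ * (μ + A * (Real.sqrt (-s) * Real.sqrt (-s₀))⁻¹ *
        ((cylPt r 0 z) 0 * (cylPt r 0 z) 0 + (cylPt r 0 z) 1 * (cylPt r 0 z) 1)) ≤ 0 at hx
    rw [hrad, hz, h0] at hx
    exact hx
  rw [← mul_sub] at hq'
  rcases mul_nonpos_iff.1 hq' with ⟨-, h2⟩ | ⟨h1, -⟩
  · have e : A * (Real.sqrt (-s) * Real.sqrt (-s₀))⁻¹ * r ^ 2 =
        Real.pi * (4 * K₁ + 1) * r ^ 2 / (Real.sqrt (-s) * Real.sqrt (-s₀)) := by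
      rw [hA]; field_simp
    linarith
  · exact absurd h1 (not_le.2 (by positivity))

/-- **THE SWEEPING LEMMA, far-field form**: `Γ(r,z,s) ≤ sup { Γ(R₁√(−s'), z', s') : s' ≤ s₁ }` for all `r ≥ 0`, `s ≤ s₁ < 0`,
`R₁ = 4C(1+K) + R₀ + 1`, under the circle cone on far circles about the axis only. -/
theorem circ_le_sSup_of_farCone (hv : InDoorClass C v) (hsign : SignE3 v) {K : ℝ} (hK : 0 ≤ K)
    {R₀ : ℝ} (hR₀ : 0 ≤ R₀) (hcone : ∀ s < 0, ∀ r : ℝ, R₀ * Real.sqrt (-s) ≤ r → ∀ z : ℝ, tiltCirc v r z s ≤ K * vortCirc v r z s)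
    {s₁ : ℝ} (hs₁ : s₁ < 0) {s : ℝ} (hs : s ≤ s₁) {r : ℝ} (hr : 0 ≤ r) (z : ℝ) :
    circ v r z s ≤ sSup {m : ℝ | ∃ s' : ℝ, s' ≤ s₁ ∧ ∃ z' : ℝ, m = circ v ((4 * (C * (1 + K)) + R₀ + 1) * Real.sqrt (-s')) z' s'} := by
  obtain ⟨K₁, hK₁0, hK₁⟩ := exists_fderiv_rate_of_class' hv.1 hv.2.1 hv.2.2.1
  set μ := sSup {m : ℝ | ∃ s' : ℝ, s' ≤ s₁ ∧ ∃ z' : ℝ, m = circ v ((4 * (C * (1 + K)) + R₀ + 1) * Real.sqrt (-s')) z' s'}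
  have hs0 : s < 0 := lt_of_le_of_lt hs hs₁
  have hsqs : 0 < Real.sqrt (-s) := Real.sqrt_pos.2 (neg_pos.2 hs0)
  refine le_of_forall_pos_le_add fun δ hδ => ?_
  set A : ℝ := Real.pi * (4 * K₁ + 1) with hA
  have hApos : 0 < A := by positivity
  set L : ℝ := A * r ^ 2 / (Real.sqrt (-s) * δ) with hL
  have hL0 : 0 ≤ L := by positivity
  set s₀ : ℝ := s - 1 - L ^ 2 with hs₀def
  have hs₀s : s₀ < s := by rw [hs₀def]; nlinarith [sq_nonneg L]
  have hs₀₁ : s₀ < s₁ := lt_of_lt_of_le hs₀s hs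
  have hsq₀ : L ≤ Real.sqrt (-s₀) := by
    rw [show L = Real.sqrt (L ^ 2) from (Real.sqrt_sq hL0).symm]
    exact Real.sqrt_le_sqrt (by rw [hs₀def]; linarith)
  have hsq₀pos : 0 < Real.sqrt (-s₀) := Real.sqrt_pos.2 (by linarith)
  have h := circ_le_of_farCone_aux hv hsign hK hR₀ hcone hK₁0 hK₁ hs₀₁ hs₁ s ⟨hs₀s.le, hs⟩ r hr z
  have hbound : Real.pi * (4 * K₁ + 1) * r ^ 2 / (Real.sqrt (-s) * Real.sqrt (-s₀)) ≤ δ := by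
    rw [← hA, div_le_iff₀ (by positivity)]
    have h1 : A * r ^ 2 = L * (Real.sqrt (-s) * δ) := by rw [hL]; field_simp
    rw [h1]
    have := mul_le_mul_of_nonneg_left hsq₀ (by positivity : 0 ≤ Real.sqrt (-s) * δ)
    nlinarith [this]
  linarith

/-- **The supremum is at most `2πR₁C`.** -/
theorem sSup_le_of_farCone (hv : InDoorClass C v) {K : ℝ} (hK : 0 ≤ K) {R₀ : ℝ} (hR₀ : 0 ≤ R₀) {s₁ : ℝ} (hs₁ : s₁ < 0) :
    sSup {m : ℝ | ∃ s' : ℝ, s' ≤ s₁ ∧ ∃ z' : ℝ, m = circ v ((4 * (C * (1 + K)) + R₀ + 1) * Real.sqrt (-s')) z' s'} ≤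
      2 * Real.pi * ((4 * (C * (1 + K)) + R₀ + 1) * C) := by
  have hC := HalfSpaceWindowDoorCirculationCarryingRigidityConeFluxSubsolution.typeI_const_nonneg hv
  have hR₁ : 0 ≤ 4 * (C * (1 + K)) + R₀ + 1 := by positivity
  obtain ⟨-, hle⟩ := tube_bddAbove hv hR₁ hs₁
  refine csSup_le ⟨_, s₁, le_rfl, 0, rfl⟩ fun m hm => ?_
  have := hle m hm
  linarith

/-- **FINITE PLANE FLUX** under the far-field circle cone: `Γ(r,z,s) ≤ 2πR₁C` for ALL `r`. -/
theorem circ_le_const_of_farCone (hv : InDoorClass C v) (hsign : SignE3 v) {K : ℝ} (hK : 0 ≤ K)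
    {R₀ : ℝ} (hR₀ : 0 ≤ R₀) (hcone : ∀ s < 0, ∀ r : ℝ, R₀ * Real.sqrt (-s) ≤ r → ∀ z : ℝ, tiltCirc v r z s ≤ K * vortCirc v r z s)
    {s : ℝ} (hs : s < 0) {r : ℝ} (hr : 0 ≤ r) (z : ℝ) :
    circ v r z s ≤ 2 * Real.pi * ((4 * (C * (1 + K)) + R₀ + 1) * C) :=
  (circ_le_sSup_of_farCone hv hsign hK hR₀ hcone hs le_rfl hr z).trans (sSup_le_of_farCone hv hK hR₀ hs)

end Summit.NavierStokesRegularity.NavierStokesRegularity.Theorems.HalfSpaceWindowDoorCirculationCarryingRigidityFarConeSweeping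

end
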